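import Summits.CriticalPhenomena.SAWScalingLimit.Theorems.BoundaryClosureNegative_Instance

/-!
# Negative knowledge on crux `BoundaryClosureR` (stmt-CriticalPhenomena-14004), part 5/5: the lattice pin
at the ROOT of `HexObservableLimitR` is load-bearing

`not_hexObservableLimit_without_rootPin`: the repaired target with the lattice pin at the root `a = pt 0`
removed (flatness of `∂Ω` at BOTH marked points and the lattice pin at `b` kept) is FALSE — the
corridor-at-the-root witness of the landed refutation `SAWDefectDecoherenceHexObservableLimit_refuted`
(old target stmt-5420: root relocated `3/4 → 1/2` along a boundary-hugging corridor, observables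
proportional, predicted densities `e^{(5/8)(L_r - L_r 0)}` incompatible) also satisfies the flatness
hypothesis at `pt 0 ∈ {1/2, 3/4}` with `ρ = 1/4` (`HD_inter_ball_real`, `instance_limit_root`).  So the
repair of stmt-5420 → stmt-14003 needed the LATTICE pin at the root, not merely a flat boundary there.
Everything proved. [folklore]
-/

noncomputable section

open Set Filter Topology Complex
open Literature.Probability.RandomPlanarGeometry
open UpperHalfPlane (upperHalfPlaneSet)
open Literature.Probability.LatticeModels Literature.Probability.RandomPlanarGeometry.SAW

namespace Summit.CriticalPhenomena.SAWScalingLimit.Theorems.BoundaryClosureR.Negative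

open BoundaryClosure.Negative

/-- **Flatness at a real point**: near a real `p` with `|p| + ρ ≤ 1` the half-disc is the upper
half-plane. [folklore] -/
theorem HD_inter_ball_real {p ρ : ℝ} (h : |p| + ρ ≤ 1) :
    HD ∩ Metric.ball (p : ℂ) ρ = {z : ℂ | (p : ℂ).im < z.im} ∩ Metric.ball (p : ℂ) ρ := by
  ext z
  simp only [HD, mem_inter_iff, mem_setOf_eq, Metric.mem_ball, Complex.ofReal_im]
  constructor
  · rintro ⟨⟨-, h1⟩, h2⟩; exact ⟨h1, h2⟩
  · rintro ⟨h1, h2⟩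
    refine ⟨⟨?_, h1⟩, h2⟩
    rw [dist_eq_norm] at h2
    calc ‖z‖ = ‖(z - p) + p‖ := by ring_nf
      _ ≤ ‖z - (p : ℂ)‖ + ‖(p : ℂ)‖ := norm_add_le _ _
      _ < ρ + |p| := by rw [Complex.norm_real, Real.norm_eq_abs]; linarith
      _ ≤ 1 := by linarith

/-! ## Part E — the root pin is load-bearing as well (the corridor witness inside the repaired frame)

The landed refutation of the old target (`SAWDefectDecoherenceHexObservableLimit_refuted`, corridor at
the ROOT) survives the flatness hypothesis at the root: the repaired target with the root's LATTICE pin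
removed — but the boundary of `Ω` flat near `a` — is still false. -/

/-- **One instance of the root-unpinned statement on the half-disc**: configuration `wc` rooted at the
FREE junction/tip edge `aEdge (rootCell δ wc)` (marked point `pt 0 = r`, boundary flat there) and
normalised at the PINNED edge `bEdge` (marked point `pt 1 = 0`, exact half-lattice in `ball 0 (1/4)`)
satisfies every hypothesis, so the normalised averages converge to `c ∫ ψ e^{(5/8)(L_r - L_r 0)}`.
[folklore] -/
theorem instance_limit_root {c : ℂ}
    (H : ∀ (D : Literature.Probability.RandomPlanarGeometry.DobrushinDomain) (ρ : ℝ)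
      (Λ : ℝ → Finset Literature.Probability.LatticeModels.HexVertex) (m : ℝ → ℤ)
      (a b : ℝ → Sym2 Literature.Probability.LatticeModels.HexVertex)
      (Φ : Literature.Probability.RandomPlanarGeometry.ConformalEquiv D.carrier UpperHalfPlane.upperHalfPlaneSet)
      (L : ℂ → ℂ) (Lb : ℂ) (ψ : ℂ → ℂ),
      let F : ℝ → Sym2 Literature.Probability.LatticeModels.HexVertex → ℂ := fun δ z =>
        Literature.Probability.RandomPlanarGeometry.SAW.hexParafermionicObservable (Λ δ) (a δ)
          Literature.Probability.RandomPlanarGeometry.SAW.hexCriticalFugacity (5 / 8) z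
      0 < ρ → (∀ i : Fin 2, D.carrier ∩ Metric.ball (D.pt i) ρ = {z : ℂ | (D.pt i).im < z.im} ∩ Metric.ball (D.pt i) ρ) →
      (∀ᶠ δ : ℝ in nhdsWithin 0 (Set.Ioi 0),
        Literature.Probability.RandomPlanarGeometry.SAW.hexDomainSimplyConnected (Λ δ) ∧
        a δ ∈ Literature.Probability.RandomPlanarGeometry.SAW.hexDomainBoundary (Λ δ) ∧
        b δ ∈ Literature.Probability.RandomPlanarGeometry.SAW.hexDomainBoundary (Λ δ) ∧
        Nonempty (Literature.Probability.RandomPlanarGeometry.SAW.HexMidEdgeSAW (Λ δ) (a δ) (b δ)) ∧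
        (Literature.Probability.LatticeModels.hexGraph.induce ((Λ δ : Finset
          Literature.Probability.LatticeModels.HexVertex) : Set
          Literature.Probability.LatticeModels.HexVertex)).Preconnected ∧
        (∀ v ∈ Λ δ, (δ : ℂ) * Literature.Probability.LatticeModels.hexCenter v ∈ D.carrier) ∧
        (∀ v : Literature.Probability.LatticeModels.HexVertex, (δ : ℂ) *
          Literature.Probability.LatticeModels.hexCenter v ∈ Metric.ball (D.pt 1) ρ → (v ∈ Λ δ ↔ m δ ≤ v.1 1))) →
      (∀ K : Set ℂ, IsCompact K → K ⊆ D.carrier → ∀ᶠ δ : ℝ in nhdsWithin 0 (Set.Ioi 0), ∀ v :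
        Literature.Probability.LatticeModels.HexVertex, (δ : ℂ) *
        Literature.Probability.LatticeModels.hexCenter v ∈ K → v ∈ Λ δ) →
      Filter.Tendsto (fun δ : ℝ => (δ : ℂ) * Literature.Probability.RandomPlanarGeometry.SAW.hexMidpoint (a δ))
        (nhdsWithin 0 (Set.Ioi 0)) (nhds (D.pt 0)) →
      Filter.Tendsto (fun δ : ℝ => (δ : ℂ) * Literature.Probability.RandomPlanarGeometry.SAW.hexMidpoint (b δ))
        (nhdsWithin 0 (Set.Ioi 0)) (nhds (D.pt 1)) →
      Filter.Tendsto (fun x => ‖Φ x‖) (nhdsWithin (D.pt 0) D.carrier) Filter.atTop →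
      Φ.HasBoundaryValue (D.pt 1) 0 → ContinuousOn L D.carrier → (∀ z ∈ D.carrier, Complex.exp (L z) = deriv Φ z) →
      Filter.Tendsto L (nhdsWithin (D.pt 1) D.carrier) (nhds Lb) → Continuous ψ → HasCompactSupport ψ →
      tsupport ψ ⊆ D.carrier →
      Filter.Tendsto (fun δ : ℝ => (δ : ℂ) ^ 2 * (∑ᶠ e ∈
        Literature.Probability.RandomPlanarGeometry.SAW.hexDomainMidEdges (Λ δ), ψ ((δ : ℂ) *
        Literature.Probability.RandomPlanarGeometry.SAW.hexMidpoint e) * F δ e) / F δ (b δ))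
        (nhdsWithin 0 (Set.Ioi 0)) (nhds (c * ∫ z, ψ z * Complex.exp ((5 / 8 : ℂ) * (L z - Lb)))))
    {r : ℝ} (hr : 0 < r ∧ r < 1) (hr' : r ≤ 3 / 4) (wc : Bool)
    (hroot : ∀ δ : ℝ, 0 < δ → |δ * rootCell δ wc - r| ≤ δ)
    {ψ : ℂ → ℂ} (hψc : Continuous ψ) (hψK : HasCompactSupport ψ) (hψD : tsupport ψ ⊆ HD) :
    Filter.Tendsto (fun δ : ℝ => (δ : ℂ) ^ 2 * (∑ᶠ e ∈ hexDomainMidEdges (Lam δ wc),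
        ψ ((δ : ℂ) * hexMidpoint e) * hexParafermionicObservable (Lam δ wc) (aEdge (rootCell δ wc))
          hexCriticalFugacity (5 / 8) e) /
        hexParafermionicObservable (Lam δ wc) (aEdge (rootCell δ wc)) hexCriticalFugacity (5 / 8) bEdge)
      (nhdsWithin 0 (Set.Ioi 0))
      (nhds (c * ∫ z, ψ z * Complex.exp ((5 / 8 : ℂ) * (Lfun r z - Lfun r 0)))) := by
  have H' := H (halfDiscDomain r hr) (1 / 4) (fun δ => Lam δ wc) (fun _ => 0) (fun δ => aEdge (rootCell δ wc))
    (fun _ => bEdge) (PhiCE r hr) (Lfun r) (Lfun r 0) ψ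
  simp only [pt_zero_halfDiscDomain, pt_one_halfDiscDomain] at H'
  refine H' (by norm_num) ?_ ?_ ?_ ?_ ?_ (tendsto_norm_PhiCE hr) (tendsto_PhiCE_zero hr)
    (continuousOn_Lfun hr) (fun z hz => exp_Lfun hr hz) (tendsto_Lfun_zero hr) hψc hψK hψD
  · -- flatness at both marked points
    refine Fin.forall_fin_two.2 ⟨?_, ?_⟩
    · rw [pt_zero_halfDiscDomain]
      show HD ∩ _ = _
      exact HD_inter_ball_real (p := r) (ρ := 1 / 4) (by rw [abs_of_pos hr.1]; linarith)
    · rw [pt_one_halfDiscDomain]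
      show HD ∩ _ = _
      simpa using HD_inter_ball_real (p := 0) (ρ := 1 / 4) (by norm_num)
  · -- the discrete hypotheses, for `0 < δ ≤ 1/16`
    filter_upwards [eventually_small one_pos] with δ hδ
    obtain ⟨hδ, hδ', -⟩ := hδ
    refine ⟨simplyConnected_Lam hδ hδ' wc, aEdge_mem_boundary hδ hδ' wc, bEdge_mem_boundary hδ hδ' wc,
      nonempty_saw hδ hδ' wc, preconnected_Lam hδ hδ' wc, fun v hv => smul_center_mem_HD hδ hδ' wc hv,
      fun v hv => ?_⟩
    refine mem_Lam_iff_of_ball hδ hδ' wc ?_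
    rw [Metric.mem_ball] at hv ⊢
    linarith
  · -- exhaustion of compacts
    intro K hK hKD
    obtain ⟨ε, hε, hε1, hthick⟩ := exists_thick_of_isCompact hK hKD
    filter_upwards [eventually_small (by positivity : 0 < ε / 4)] with δ hδ v hv
    obtain ⟨hδ, hδ', hδε⟩ := hδ
    obtain ⟨hn, hi⟩ := hthick _ hv
    exact mem_Lam_of_thick hδ hδ' wc hδε hn hi
  · exact tendsto_smul_midpoint_aEdge hroot
  · exact tendsto_smul_midpoint_bEdge

/-- **Refutation of `HexObservableLimitR` with the root's lattice pin removed** (normaliser pinned,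
boundary FLAT near the root, discretisation exact only at the normaliser): the corridor witness of
`SAWDefectDecoherenceHexObservableLimit_refuted` (root relocated `3/4 → 1/2` along a boundary-hugging
corridor, observables proportional, predicted densities `e^{(5/8)(L_r - L_r 0)}` incompatible) satisfies
the extra flatness hypothesis, so it still bites.  Hence the rigid half-lattice ball at the ROOT is
load-bearing in `HexObservableLimitR` (flatness of `∂Ω` near `a` and `a_δ → a` do not suffice). [folklore] -/
theorem not_hexObservableLimit_without_rootPin : ¬ ∃ c : ℂ, c ≠ 0 ∧
    ∀ (D : Literature.Probability.RandomPlanarGeometry.DobrushinDomain) (ρ : ℝ)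
      (Λ : ℝ → Finset Literature.Probability.LatticeModels.HexVertex) (m : ℝ → ℤ)
      (a b : ℝ → Sym2 Literature.Probability.LatticeModels.HexVertex)
      (Φ : Literature.Probability.RandomPlanarGeometry.ConformalEquiv D.carrier UpperHalfPlane.upperHalfPlaneSet)
      (L : ℂ → ℂ) (Lb : ℂ) (ψ : ℂ → ℂ),
      let F : ℝ → Sym2 Literature.Probability.LatticeModels.HexVertex → ℂ := fun δ z =>
        Literature.Probability.RandomPlanarGeometry.SAW.hexParafermionicObservable (Λ δ) (a δ)
          Literature.Probability.RandomPlanarGeometry.SAW.hexCriticalFugacity (5 / 8) z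
      0 < ρ → (∀ i : Fin 2, D.carrier ∩ Metric.ball (D.pt i) ρ = {z : ℂ | (D.pt i).im < z.im} ∩ Metric.ball (D.pt i) ρ) →
      (∀ᶠ δ : ℝ in nhdsWithin 0 (Set.Ioi 0),
        Literature.Probability.RandomPlanarGeometry.SAW.hexDomainSimplyConnected (Λ δ) ∧
        a δ ∈ Literature.Probability.RandomPlanarGeometry.SAW.hexDomainBoundary (Λ δ) ∧
        b δ ∈ Literature.Probability.RandomPlanarGeometry.SAW.hexDomainBoundary (Λ δ) ∧
        Nonempty (Literature.Probability.RandomPlanarGeometry.SAW.HexMidEdgeSAW (Λ δ) (a δ) (b δ)) ∧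
        (Literature.Probability.LatticeModels.hexGraph.induce ((Λ δ : Finset
          Literature.Probability.LatticeModels.HexVertex) : Set
          Literature.Probability.LatticeModels.HexVertex)).Preconnected ∧
        (∀ v ∈ Λ δ, (δ : ℂ) * Literature.Probability.LatticeModels.hexCenter v ∈ D.carrier) ∧
        (∀ v : Literature.Probability.LatticeModels.HexVertex, (δ : ℂ) *
          Literature.Probability.LatticeModels.hexCenter v ∈ Metric.ball (D.pt 1) ρ → (v ∈ Λ δ ↔ m δ ≤ v.1 1))) →
      (∀ K : Set ℂ, IsCompact K → K ⊆ D.carrier → ∀ᶠ δ : ℝ in nhdsWithin 0 (Set.Ioi 0), ∀ v :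
        Literature.Probability.LatticeModels.HexVertex, (δ : ℂ) *
        Literature.Probability.LatticeModels.hexCenter v ∈ K → v ∈ Λ δ) →
      Filter.Tendsto (fun δ : ℝ => (δ : ℂ) * Literature.Probability.RandomPlanarGeometry.SAW.hexMidpoint (a δ))
        (nhdsWithin 0 (Set.Ioi 0)) (nhds (D.pt 0)) →
      Filter.Tendsto (fun δ : ℝ => (δ : ℂ) * Literature.Probability.RandomPlanarGeometry.SAW.hexMidpoint (b δ))
        (nhdsWithin 0 (Set.Ioi 0)) (nhds (D.pt 1)) →
      Filter.Tendsto (fun x => ‖Φ x‖) (nhdsWithin (D.pt 0) D.carrier) Filter.atTop →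
      Φ.HasBoundaryValue (D.pt 1) 0 → ContinuousOn L D.carrier → (∀ z ∈ D.carrier, Complex.exp (L z) = deriv Φ z) →
      Filter.Tendsto L (nhdsWithin (D.pt 1) D.carrier) (nhds Lb) → Continuous ψ → HasCompactSupport ψ →
      tsupport ψ ⊆ D.carrier →
      Filter.Tendsto (fun δ : ℝ => (δ : ℂ) ^ 2 * (∑ᶠ e ∈
        Literature.Probability.RandomPlanarGeometry.SAW.hexDomainMidEdges (Λ δ), ψ ((δ : ℂ) *
        Literature.Probability.RandomPlanarGeometry.SAW.hexMidpoint e) * F δ e) / F δ (b δ))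
        (nhdsWithin 0 (Set.Ioi 0)) (nhds (c * ∫ z, ψ z * Complex.exp ((5 / 8 : ℂ) * (L z - Lb)))) := by
  rintro ⟨c, hc, H⟩
  have hp : (0 : ℝ) < 3 / 4 ∧ (3 / 4 : ℝ) < 1 := by norm_num
  have hq : (0 : ℝ) < 1 / 2 ∧ (1 / 2 : ℝ) < 1 := by norm_num
  have hx : hexCriticalFugacity ≠ 0 := hexCriticalFugacity_pos_lt_one.1.ne'
  -- Step 1: for every test function the two predicted limits coincide
  have key : ∀ ψ : ℂ → ℂ, Continuous ψ → HasCompactSupport ψ → tsupport ψ ⊆ HD →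
      c * ∫ z, ψ z * Complex.exp ((5 / 8 : ℂ) * (Lfun (1 / 2) z - Lfun (1 / 2) 0)) =
        c * ∫ z, ψ z * Complex.exp ((5 / 8 : ℂ) * (Lfun (3 / 4) z - Lfun (3 / 4) 0)) := by
    intro ψ hψc hψK hψD
    have h1 := instance_limit_root H hq (by norm_num) false (fun δ hδ => abs_Xc δ hδ) hψc hψK hψD
    have h2 := instance_limit_root H hp le_rfl true (fun δ hδ => abs_Tc δ hδ) hψc hψK hψD
    simp only [rootCell, Bool.false_eq_true, ↓reduceIte] at h1
    simp only [rootCell, ↓reduceIte] at h2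
    -- the two normalised averages agree for small `δ`
    obtain ⟨ε, hε, -, hthick⟩ := exists_thick_of_isCompact hψK hψD
    have heq : (fun δ : ℝ => (δ : ℂ) ^ 2 * (∑ᶠ e ∈ hexDomainMidEdges (Lam δ true),
        ψ ((δ : ℂ) * hexMidpoint e) * hexParafermionicObservable (Lam δ true) (aEdge (Tc δ))
          hexCriticalFugacity (5 / 8) e) /
        hexParafermionicObservable (Lam δ true) (aEdge (Tc δ)) hexCriticalFugacity (5 / 8) bEdge)
        =ᶠ[𝓝[>] 0]
        fun δ : ℝ => (δ : ℂ) ^ 2 * (∑ᶠ e ∈ hexDomainMidEdges (Lam δ false),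
        ψ ((δ : ℂ) * hexMidpoint e) * hexParafermionicObservable (Lam δ false) (aEdge (Xc δ))
          hexCriticalFugacity (5 / 8) e) /
        hexParafermionicObservable (Lam δ false) (aEdge (Xc δ)) hexCriticalFugacity (5 / 8) bEdge := by
      filter_upwards [eventually_small (by positivity : 0 < ε / 2)] with δ hδ
      obtain ⟨hδ, hδ', hδε⟩ := hδ
      refine ratio_eq hδ hδ' _ _ hx ψ fun e he => ?_
      have hmem : (δ : ℂ) * hexMidpoint e ∈ tsupport ψ := subset_tsupport _ he
      have him := (hthick _ hmem).2
      rw [Complex.im_ofReal_mul] at him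
      by_contra hlt
      push Not at hlt
      nlinarith
    exact tendsto_nhds_unique h1 (h2.congr' heq)
  -- Step 2: the difference of the two densities is orthogonal to all test functions, hence zero
  have hG : ∀ z ∈ HD, Complex.exp ((5 / 8 : ℂ) * (Lfun (1 / 2) z - Lfun (1 / 2) 0)) =
      Complex.exp ((5 / 8 : ℂ) * (Lfun (3 / 4) z - Lfun (3 / 4) 0)) := by
    intro z hz
    have := eq_zero_of_forall_integral isOpen_HD
      (G := fun z => Complex.exp ((5 / 8 : ℂ) * (Lfun (1 / 2) z - Lfun (1 / 2) 0)) -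
        Complex.exp ((5 / 8 : ℂ) * (Lfun (3 / 4) z - Lfun (3 / 4) 0)))
      ((continuousOn_g hq).sub (continuousOn_g hp)) (fun ψ hψc hψK hψD => ?_) hz
    · exact sub_eq_zero.1 this
    · have i1 : MeasureTheory.Integrable fun z => ψ z * Complex.exp ((5 / 8 : ℂ) * (Lfun (1 / 2) z - Lfun (1 / 2) 0)) :=
        (continuous_mul_of_tsupport_subset isOpen_HD hψc hψD (continuousOn_g hq)).integrable_of_hasCompactSupport
          hψK.mul_right
      have i2 : MeasureTheory.Integrable fun z => ψ z * Complex.exp ((5 / 8 : ℂ) * (Lfun (3 / 4) z - Lfun (3 / 4) 0)) :=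
        (continuous_mul_of_tsupport_subset isOpen_HD hψc hψD (continuousOn_g hp)).integrable_of_hasCompactSupport
          hψK.mul_right
      show ∫ z, ψ z * (Complex.exp ((5 / 8 : ℂ) * (Lfun (1 / 2) z - Lfun (1 / 2) 0)) -
          Complex.exp ((5 / 8 : ℂ) * (Lfun (3 / 4) z - Lfun (3 / 4) 0))) = 0
      have e : (fun z => ψ z * (Complex.exp ((5 / 8 : ℂ) * (Lfun (1 / 2) z - Lfun (1 / 2) 0)) -
          Complex.exp ((5 / 8 : ℂ) * (Lfun (3 / 4) z - Lfun (3 / 4) 0)))) =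
          fun z => ψ z * Complex.exp ((5 / 8 : ℂ) * (Lfun (1 / 2) z - Lfun (1 / 2) 0)) -
            ψ z * Complex.exp ((5 / 8 : ℂ) * (Lfun (3 / 4) z - Lfun (3 / 4) 0)) := by
        funext z; ring
      rw [e, MeasureTheory.integral_sub i1 i2, sub_eq_zero]
      exact mul_left_cancel₀ hc (key ψ hψc hψK hψD)
  -- Step 3: the two normalisations are incompatible
  exact endgame hp hq (by norm_num) hG

end Summit.CriticalPhenomena.SAWScalingLimit.Theorems.BoundaryClosureR.Negative
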